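import Summits.Ventures.LatticeQCDFlow.Scaling.ParallelTemperingPairCycle

/-!
HONEST FRAMING: exact (Metropolis-corrected) sampling algorithms for lattice gauge theory; figures
of merit are autocorrelation/cost numbers at stated couplings and volumes; no continuum-physics
claim.

# ParallelTemperingPairCycleMoves — THE EXACT TAG-MOVE PROBABILITY OF A SWEEP OF SWAP ATTEMPTS OVER PAIRWISE
# DISJOINT PAIRS, `Σ_{j ∈ js} ptTagCoef_j·ptPairRatio_j`, AND ITS STATIONARY MEAN `(2/(K+1))·Σ_{j ∈ js} swapAcc_j`
# (lean-2 GEN-15, ours)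

Venture-side (OURS).  Cell `lqcd-flow` (pub-lqcd), unit `pub-lqcd-lean-2-g15`, 2026-08-24.  Companion of
`Scaling/ParallelTemperingPairCycle` (the sweep `ptPairCycle js = cycle (js.map κ_j)` over a list of pairwise
disjoint adjacent pairs: Markov, detailed balance, nearest-neighbour tag moves).  Here: hypothesis (iii) of GEN-13's
replica-exchange law (`Scaling/ParallelTemperingDiffusive.pt_level_lagOneAutocorr_ge`) for the sweep, EXACTLY.
Mechanism: by induction along the list; the attempt at a pair NOT carrying the original tag never changes whether
the tag has moved (`indicator_tagMoved_swap_of_perm_eq`), and when the pair `j` carries it, the earlier attempts (at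
pairs disjoint from `j`) have almost surely neither moved the tag nor changed the ratio `r_j`
(`ptPairCycle_tagClosed`, `ptPairCycle_ratio_ae_eq`).

## What is proved

* `ptTagCoef_eq_ite` (`ptTagCoef K j τ = 1[σ_j τ ≠ τ]`); **`ptPairCycle_apply_moves`** / **`ptPairCycle_real_moves_eq`**:
  for a pairwise disjoint list, `C_js(z){tag ≠ tag z} = Σ_{j ∈ js} ptTagCoef K j (tag z)·r_j(z)` (at most one term
  non-zero: `ptPairCycle_moveFn_le_one`); `ptPairCycle_real_moves_le_ptSwapRatio` (`≤ ptSwapRatio`: GEN-13's law and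
  GEN-14's `Scaling/ParallelTemperingAlgorithm` apply to `M ∘ₖ C_js` verbatim).
* `integral_tagCoef_mul_pairRatio` (`∫ ptTagCoef_j·r_j dπ = (2/(K+1))·swapAcc_j`); **`ptPairCycle_moveRate_eq`** —
  the stationary tag-move rate of the sweep is `(2/(K+1))·Σ_{j ∈ js} swapAcc X μ β_j β_{j+1}`.

NOT CLAIMED here: the even/odd specialisation and the laws (`Scaling/ParallelTemperingHalfSweep`); anything
measured.  Literature grade (cell rule): TEXTBOOK ALGORITHM, NEW TYPING; nothing cited as a fact; no new bib keys.
-/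

noncomputable section

open MeasureTheory ProbabilityTheory Set Filter Finset
open Summit.Ventures.LatticeQCDFlow.Exactness
open scoped ENNReal

namespace Summit.Ventures.LatticeQCDFlow.Scaling

/-! ## §4 (iii) The exact tag-move probability of the sweep and its stationary mean -/

section Moves

variable {Ω : Type*} [MeasurableSpace Ω] {X : Ω → ℝ} {μ : Measure Ω} {β : ℕ → ℝ} {K : ℕ}

omit [MeasurableSpace Ω] in
/-- The tag's incidence coefficient with a pair, as an indicator: `ptTagCoef K j τ = 1[σ_j τ ≠ τ]`. [ours] -/
theorem ptTagCoef_eq_ite (j : Fin K) (τ : Fin (K + 1)) :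
    ptTagCoef K j τ = if ptPerm K j τ = τ then 0 else 1 := by
  by_cases h : ptPerm K j τ = τ
  · rw [if_pos h]
    have h' : ¬ (τ = Fin.castSucc j ∨ τ = Fin.succ j) := fun hor => ((ptPerm_ne_self_iff j τ).2 hor) h
    push Not at h'
    unfold ptTagCoef
    rw [if_neg (Ne.symm h'.1), if_neg (Ne.symm h'.2), add_zero]
  · rw [if_neg h, ptTagCoef_eq_one_of_ne j τ h]

/-- The set "the tag has moved" is measurable. [folklore] -/
theorem measurableSet_tagMoved (z : Fin (K + 1) × (Fin (K + 1) → Ω)) :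
    MeasurableSet {y : Fin (K + 1) × (Fin (K + 1) → Ω) | ((y.1 : Fin (K + 1)) : ℕ) ≠ ((z.1 : Fin (K + 1)) : ℕ)} := by
  have e : {y : Fin (K + 1) × (Fin (K + 1) → Ω) | ((y.1 : Fin (K + 1)) : ℕ) ≠ ((z.1 : Fin (K + 1)) : ℕ)} =
      (fun y : Fin (K + 1) × (Fin (K + 1) → Ω) => ((y.1 : Fin (K + 1)) : ℕ)) ⁻¹' {n : ℕ | n ≠ ((z.1 : Fin (K + 1)) : ℕ)} := by
    ext y; simp
  rw [e]; exact measurable_ptLevel MeasurableSet.of_discrete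

omit [MeasurableSpace Ω] in
/-- A pair whose transposition fixes the tag does not change whether the tag has moved:
`1_S(swap_j y) = 1_S(y)` for `S = {tag ≠ tag z}` when `σ_j (tag z) = tag z`. [ours] -/
theorem indicator_tagMoved_swap_of_perm_eq (j : Fin K) {z : Fin (K + 1) × (Fin (K + 1) → Ω)}
    (hz : ptPerm K j z.1 = z.1) (y : Fin (K + 1) × (Fin (K + 1) → Ω)) :
    ({y' : Fin (K + 1) × (Fin (K + 1) → Ω) | ((y'.1 : Fin (K + 1)) : ℕ) ≠ ((z.1 : Fin (K + 1)) : ℕ)}).indicator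
        (1 : Fin (K + 1) × (Fin (K + 1) → Ω) → ℝ≥0∞) (ptSwapMap K j y) =
      ({y' : Fin (K + 1) × (Fin (K + 1) → Ω) | ((y'.1 : Fin (K + 1)) : ℕ) ≠ ((z.1 : Fin (K + 1)) : ℕ)}).indicator 1 y := by
  by_cases hy : ptPerm K j y.1 = y.1
  · -- the tag of `y` is not on the pair: the swap does not move it
    have e : (ptSwapMap K j y).1 = y.1 := by simp only [ptSwapMap, hy]
    by_cases hmem : y ∈ {y' : Fin (K + 1) × (Fin (K + 1) → Ω) | ((y'.1 : Fin (K + 1)) : ℕ) ≠ ((z.1 : Fin (K + 1)) : ℕ)}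
    · have hmem' : ptSwapMap K j y ∈
          {y' : Fin (K + 1) × (Fin (K + 1) → Ω) | ((y'.1 : Fin (K + 1)) : ℕ) ≠ ((z.1 : Fin (K + 1)) : ℕ)} := by
        rw [Set.mem_setOf_eq, e]; exact hmem
      simp only [Set.indicator_of_mem hmem, Set.indicator_of_mem hmem', Pi.one_apply]
    · have hmem' : ptSwapMap K j y ∉
          {y' : Fin (K + 1) × (Fin (K + 1) → Ω) | ((y'.1 : Fin (K + 1)) : ℕ) ≠ ((z.1 : Fin (K + 1)) : ℕ)} := by
        rw [Set.mem_setOf_eq, e]; exact hmem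
      rw [Set.indicator_of_notMem hmem, Set.indicator_of_notMem hmem']
  · -- the tag of `y` is on the pair, the tag of `z` is not: both `y` and `swap_j y` have moved tags
    have hy' : y.1 = Fin.castSucc j ∨ y.1 = Fin.succ j := (ptPerm_ne_self_iff j y.1).1 hy
    have hz' : ¬ (z.1 = Fin.castSucc j ∨ z.1 = Fin.succ j) := fun hor => ((ptPerm_ne_self_iff j z.1).2 hor) hz
    have hmem : y ∈ {y' : Fin (K + 1) × (Fin (K + 1) → Ω) | ((y'.1 : Fin (K + 1)) : ℕ) ≠ ((z.1 : Fin (K + 1)) : ℕ)} := by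
      rw [Set.mem_setOf_eq]
      intro h
      have h' : y.1 = z.1 := Fin.ext h
      rw [h'] at hy'
      exact hz' hy'
    have hmem' : ptSwapMap K j y ∈
        {y' : Fin (K + 1) × (Fin (K + 1) → Ω) | ((y'.1 : Fin (K + 1)) : ℕ) ≠ ((z.1 : Fin (K + 1)) : ℕ)} := by
      rw [Set.mem_setOf_eq]
      intro h
      have h' : ptPerm K j y.1 = z.1 := Fin.ext h
      apply hz'
      rw [← h']
      rcases hy' with e | e
      · rw [e, ptPerm_castSucc]; exact Or.inr rfl
      · rw [e, ptPerm_succ]; exact Or.inl rfl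
    simp only [Set.indicator_of_mem hmem, Set.indicator_of_mem hmem', Pi.one_apply]

/-- **(iii) THE EXACT PROBABILITY THAT A SWEEP OVER PAIRWISE DISJOINT PAIRS MOVES THE TAG**:
`C_js(z){tag ≠ tag z} = Σ_{j ∈ js} ptTagCoef K j (tag z)·r_j(z)` (in `ℝ≥0∞`; at most one term is non-zero).
[ours] -/
theorem ptPairCycle_apply_moves (hXm : Measurable X) {js : List (Fin K)}
    (hjs : js.Pairwise fun j j' : Fin K => (j : ℕ) + 2 ≤ j' ∨ (j' : ℕ) + 2 ≤ j) (z : Fin (K + 1) × (Fin (K + 1) → Ω)) :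
    ptPairCycle hXm β K js z {y | ((y.1 : Fin (K + 1)) : ℕ) ≠ ((z.1 : Fin (K + 1)) : ℕ)} =
      ENNReal.ofReal (∑ j ∈ js.toFinset, ptTagCoef K j z.1 * ptPairRatio X β K j z.2) := by
  classical
  induction js with
  | nil =>
      rw [ptPairCycle_nil, Kernel.id_apply, Measure.dirac_apply' _ (measurableSet_tagMoved z)]
      simp
  | cons j rest ih =>
      rw [List.pairwise_cons] at hjs
      have hS := measurableSet_tagMoved (Ω := Ω) z
      set S : Set (Fin (K + 1) × (Fin (K + 1) → Ω)) :=
        {y | ((y.1 : Fin (K + 1)) : ℕ) ≠ ((z.1 : Fin (K + 1)) : ℕ)} with hS_def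
      have hjmem : j ∉ rest.toFinset := by
        intro hj
        rcases hjs.1 j (List.mem_toFinset.1 hj) with h | h <;> omega
      rw [List.toFinset_cons, Finset.sum_insert hjmem, ptPairCycle_cons, Kernel.comp_apply' _ _ _ hS]
      -- the inner integrand
      have hinner : ∀ y, ptPairKernel hXm β K j y S =
          ENNReal.ofReal (ptPairRatio X β K j y.2) * S.indicator 1 (ptSwapMap K j y) +
            ENNReal.ofReal (1 - ptPairRatio X β K j y.2) * S.indicator 1 y := fun y => ptPairKernel_apply' hXm j y hS
      simp only [hinner]
      by_cases hz : ptPerm K j z.1 = z.1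
      · -- the tag is not on the pair `j`: this attempt never changes whether the tag has moved
        have e : ∀ y, ENNReal.ofReal (ptPairRatio X β K j y.2) * S.indicator 1 (ptSwapMap K j y) +
            ENNReal.ofReal (1 - ptPairRatio X β K j y.2) * S.indicator 1 y = S.indicator 1 y := by
          intro y
          rw [hS_def, indicator_tagMoved_swap_of_perm_eq j hz y, ← add_mul, ofReal_ptPairRatio_add, one_mul]
        simp only [e]
        rw [lintegral_indicator_one hS, ih hjs.2, ptTagCoef_eq_ite, if_pos hz, zero_mul, zero_add]
      · -- the tag is on the pair `j`, hence on no pair of `rest`: before this attempt it has not moved, and the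
        -- ratio of the pair `j` is still `r_j(z)`
        have hT : ∀ j' ∈ rest, ∀ τ ∈ ({z.1} : Set (Fin (K + 1))), ptPerm K j' τ ∈ ({z.1} : Set (Fin (K + 1))) := by
          intro j' hj' τ hτ
          rw [Set.mem_singleton_iff] at hτ
          subst hτ
          exact ptPerm_eq_self_of_apart (Or.symm (hjs.1 j' hj')) hz
        have h1 : ∀ᵐ y ∂(ptPairCycle hXm β K rest z), y.1 = z.1 := by
          rw [ae_iff]
          exact ptPairCycle_tagClosed hXm hT rfl
        have h2 : ∀ᵐ y ∂(ptPairCycle hXm β K rest z), ptPairRatio X β K j y.2 = ptPairRatio X β K j z.2 := by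
          rw [ae_iff]
          exact ptPairCycle_ratio_ae_eq hXm hjs.1 z
        have hzS : ∀ y : Fin (K + 1) × (Fin (K + 1) → Ω), y.1 = z.1 → y ∉ S := fun y hy => by
          rw [hS_def, Set.mem_setOf_eq, not_not, hy]
        have hsS : ∀ y : Fin (K + 1) × (Fin (K + 1) → Ω), y.1 = z.1 → ptSwapMap K j y ∈ S := fun y hy => by
          rw [hS_def, Set.mem_setOf_eq]
          intro h
          have h' : ptPerm K j y.1 = z.1 := Fin.ext h
          rw [hy] at h'
          exact hz h'
        have e : (fun y => ENNReal.ofReal (ptPairRatio X β K j y.2) * S.indicator 1 (ptSwapMap K j y) +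
            ENNReal.ofReal (1 - ptPairRatio X β K j y.2) * S.indicator 1 y) =ᵐ[ptPairCycle hXm β K rest z]
            fun _ => ENNReal.ofReal (ptPairRatio X β K j z.2) := by
          filter_upwards [h1, h2] with y hy1 hy2
          rw [Set.indicator_of_mem (hsS y hy1), Set.indicator_of_notMem (hzS y hy1), hy2, Pi.one_apply, mul_one,
            mul_zero, add_zero]
        rw [lintegral_congr_ae e, lintegral_const, measure_univ, mul_one, ptTagCoef_eq_ite, if_neg hz, one_mul]
        -- the remaining terms vanish: the tag is on no pair of `rest`
        have hrest : ∑ j' ∈ rest.toFinset, ptTagCoef K j' z.1 * ptPairRatio X β K j' z.2 = 0 := by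
          refine Finset.sum_eq_zero fun j' hj' => ?_
          rw [ptTagCoef_eq_ite, if_pos (ptPerm_eq_self_of_apart (Or.symm (hjs.1 j' (List.mem_toFinset.1 hj'))) hz),
            zero_mul]
        rw [hrest, add_zero]

/-- **(iii) in real form**: `C_js(z){tag ≠ tag z} = Σ_{j ∈ js} ptTagCoef K j (tag z)·r_j(z)`. [ours] -/
theorem ptPairCycle_real_moves_eq (hXm : Measurable X) {js : List (Fin K)}
    (hjs : js.Pairwise fun j j' : Fin K => (j : ℕ) + 2 ≤ j' ∨ (j' : ℕ) + 2 ≤ j) (z : Fin (K + 1) × (Fin (K + 1) → Ω)) :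
    (ptPairCycle hXm β K js z).real {y | ((y.1 : Fin (K + 1)) : ℕ) ≠ ((z.1 : Fin (K + 1)) : ℕ)} =
      ∑ j ∈ js.toFinset, ptTagCoef K j z.1 * ptPairRatio X β K j z.2 := by
  rw [measureReal_def, ptPairCycle_apply_moves hXm hjs z,
    ENNReal.toReal_ofReal (Finset.sum_nonneg fun j _ => mul_nonneg (ptTagCoef_mem j z.1).1 (ptPairRatio_mem j z.2).1)]

/-- **(iii') THE SWEEP MOVES THE TAG WITH PROBABILITY AT MOST `ptSwapRatio`** (hypothesis `hmove` of GEN-13's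
`pt_level_lagOneAutocorr_ge`, whose docstring anticipated exactly this use). [ours] -/
theorem ptPairCycle_real_moves_le_ptSwapRatio (hXm : Measurable X) {js : List (Fin K)}
    (hjs : js.Pairwise fun j j' : Fin K => (j : ℕ) + 2 ≤ j' ∨ (j' : ℕ) + 2 ≤ j) (z : Fin (K + 1) × (Fin (K + 1) → Ω)) :
    (ptPairCycle hXm β K js z).real {y | ((y.1 : Fin (K + 1)) : ℕ) ≠ ((z.1 : Fin (K + 1)) : ℕ)} ≤
      ptSwapRatio X β K z := by
  classical
  rw [ptPairCycle_real_moves_eq hXm hjs z, ptSwapRatio]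
  exact Finset.sum_le_sum_of_subset_of_nonneg (Finset.subset_univ _)
    fun j _ _ => mul_nonneg (ptTagCoef_mem j z.1).1 (ptPairRatio_mem j z.2).1

omit [MeasurableSpace Ω] in
/-- The move-probability function of the sweep is bounded by `1` (at most one pair carries the tag). [ours] -/
theorem ptPairCycle_moveFn_le_one {js : List (Fin K)}
    (hjs : js.Pairwise fun j j' : Fin K => (j : ℕ) + 2 ≤ j' ∨ (j' : ℕ) + 2 ≤ j) (z : Fin (K + 1) × (Fin (K + 1) → Ω)) :
    ∑ j ∈ js.toFinset, ptTagCoef K j z.1 * ptPairRatio X β K j z.2 ≤ 1 := by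
  classical
  -- at most one pair of `js` carries the tag
  by_cases hon : ∃ j ∈ js, ptPerm K j z.1 ≠ z.1
  · obtain ⟨j, hj, hne⟩ := hon
    have hjF : j ∈ js.toFinset := List.mem_toFinset.2 hj
    rw [← Finset.add_sum_erase _ _ hjF]
    have hrest : ∑ j' ∈ js.toFinset.erase j, ptTagCoef K j' z.1 * ptPairRatio X β K j' z.2 = 0 := by
      refine Finset.sum_eq_zero fun j' hj' => ?_
      have hne' : j' ≠ j := Finset.ne_of_mem_erase hj'
      have hmem' : j' ∈ js := List.mem_toFinset.1 (Finset.mem_of_mem_erase hj')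
      rw [ptTagCoef_eq_ite, if_pos (ptPerm_eq_self_of_apart (forall_apart_of_pairwise hjs j' hmem' j hj hne') hne),
        zero_mul]
    rw [hrest, add_zero, ptTagCoef_eq_one_of_ne j z.1 hne, one_mul]
    exact (ptPairRatio_mem j z.2).2
  · push Not at hon
    have h0 : ∑ j ∈ js.toFinset, ptTagCoef K j z.1 * ptPairRatio X β K j z.2 = 0 := by
      refine Finset.sum_eq_zero fun j hj => ?_
      rw [ptTagCoef_eq_ite, if_pos (hon j (List.mem_toFinset.1 hj)), zero_mul]
    rw [h0]; exact zero_le_one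

variable [IsProbabilityMeasure μ]

/-- **Each pair's tag-weighted ratio integrates to `(2/(K+1))·swapAcc`**:
`∫ ptTagCoef K j (tag z)·r_j(z) dπ = (2/(K+1))·swapAcc X μ β_j β_{j+1}`. [ours] -/
theorem integral_tagCoef_mul_pairRatio (hXm : Measurable X) (hXb : ∃ C, ∀ x, |X x| ≤ C) (j : Fin K) :
    ∫ z, ptTagCoef K j z.1 * ptPairRatio X β K j z.2 ∂(ptTaggedTarget X μ β K) =
      2 / (K + 1) * swapAcc X μ (β (j : ℕ)) (β ((j : ℕ) + 1)) := by
  haveI := isProbabilityMeasure_pi_tilted (μ := μ) (β := β) (K := K) hXm hXb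
  have hm : Measurable fun z : Fin (K + 1) × (Fin (K + 1) → Ω) => ptTagCoef K j z.1 * ptPairRatio X β K j z.2 := by
    refine measurable_from_prod_countable_right fun τ => ?_
    dsimp only
    exact (measurable_ptPairRatio (β := β) hXm j).const_mul (ptTagCoef K j τ)
  have hb : ∀ z : Fin (K + 1) × (Fin (K + 1) → Ω), |ptTagCoef K j z.1 * ptPairRatio X β K j z.2| ≤ 2 := fun z => by
    rw [abs_of_nonneg (mul_nonneg (ptTagCoef_mem j z.1).1 (ptPairRatio_mem j z.2).1)]
    have h1 := ptTagCoef_mem j z.1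
    have h2 := ptPairRatio_mem (X := X) (β := β) j z.2
    nlinarith
  rw [integral_ptTaggedTarget hm hb]
  have hτ : ∀ τ : Fin (K + 1), ∫ x, ptTagCoef K j τ * ptPairRatio X β K j x
      ∂(Measure.pi fun k : Fin (K + 1) => μ.tilted fun x => β k * X x) =
      ptTagCoef K j τ * swapAcc X μ (β (j : ℕ)) (β ((j : ℕ) + 1)) := fun τ => by
    rw [MeasureTheory.integral_const_mul, integral_ptPairRatio_eq_swapAcc hXm hXb j]
  simp only [hτ]
  rw [← Finset.sum_mul, sum_ptTagCoef]
  ring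

/-- **THE STATIONARY TAG-MOVE RATE OF A SWEEP OVER PAIRWISE DISJOINT PAIRS**:
`∫ C_js(z){tag moves} dπ = (2/(K+1))·Σ_{j ∈ js} swapAcc X μ β_j β_{j+1}`. [ours] -/
theorem ptPairCycle_moveRate_eq (hXm : Measurable X) (hXb : ∃ C, ∀ x, |X x| ≤ C) {js : List (Fin K)}
    (hjs : js.Pairwise fun j j' : Fin K => (j : ℕ) + 2 ≤ j' ∨ (j' : ℕ) + 2 ≤ j) :
    ∫ z, (ptPairCycle hXm β K js z).real {y | ((y.1 : Fin (K + 1)) : ℕ) ≠ ((z.1 : Fin (K + 1)) : ℕ)}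
        ∂(ptTaggedTarget X μ β K) =
      2 / (K + 1) * ∑ j ∈ js.toFinset, swapAcc X μ (β (j : ℕ)) (β ((j : ℕ) + 1)) := by
  haveI := isProbabilityMeasure_ptTaggedTarget (μ := μ) (β := β) (K := K) hXm hXb
  simp only [ptPairCycle_real_moves_eq hXm hjs]
  have hi : ∀ j : Fin K, Integrable (fun z : Fin (K + 1) × (Fin (K + 1) → Ω) => ptTagCoef K j z.1 * ptPairRatio X β K j z.2)
      (ptTaggedTarget X μ β K) := fun j => by
    have hm : Measurable fun z : Fin (K + 1) × (Fin (K + 1) → Ω) => ptTagCoef K j z.1 * ptPairRatio X β K j z.2 := by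
      refine measurable_from_prod_countable_right fun τ => ?_
      dsimp only
      exact (measurable_ptPairRatio (β := β) hXm j).const_mul (ptTagCoef K j τ)
    refine Integrable.of_bound hm.aestronglyMeasurable 2 (ae_of_all _ fun z => ?_)
    rw [Real.norm_eq_abs, abs_of_nonneg (mul_nonneg (ptTagCoef_mem j z.1).1 (ptPairRatio_mem j z.2).1)]
    have h1 := ptTagCoef_mem j z.1
    have h2 := ptPairRatio_mem (X := X) (β := β) j z.2
    nlinarith
  rw [integral_finsetSum _ fun j _ => hi j, Finset.mul_sum]
  exact Finset.sum_congr rfl fun j _ => integral_tagCoef_mul_pairRatio hXm hXb j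

end Moves

end Summit.Ventures.LatticeQCDFlow.Scaling

end
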